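import Literature.Topology.FourManifolds.FishtailTubeALocal
import HarnessLib

/-!
# The planar shell along the whole path (flat line, quarter bend, vertical line)

Infrastructure for the explicit fishtail neighbourhood (R. Gompf, *More Cappell–Shaneson spheres
are standard*, Algebr. Geom. Topol. 10 (2010), proof of Thm 2.1 and Lemma 2.2; the named fact
`Literature.Topology.FourManifolds.gompf2010_framedTwist`). `FishtailProfile.lean` provides three
planar shells: `flatPt u₀ a` over the bottom line, `bendPt ψ a` around the quarter bend about
`C = (3ρ, ρ)`, and `footPt y a` along the vertical line `u = 2ρ`, agreeing on overlaps. Here they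
are unified into ONE shell parametrised by the polar angle `ψ ∈ (-π/2, π)` about `C`
(the bottom line is `u₀ = 3ρ - ρ tan ψ`, the vertical line is `y = ρ - ρ cos ψ / sin ψ`):

* `Literature.Topology.FourManifolds.pathShell ρ (ψ, a)` — `flatPt` for `ψ ≤ ψ₁`,
  `bendPt` for `ψ₁ < ψ ≤ π/2`, `footPt` beyond, with `ψ₁ = (arctan (1/2) + π/6)/2`;
  it is the flat shell on `ψ < π/6`, the bend shell on `arctan (1/2) < ψ ≤ π - arctan 2`, the foot
  shell on `π/3 < ψ` (`pathShell_eq_flat/bend/foot`), hence smooth on `-π/2 < ψ < π`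
  (`contDiffAt_pathShell`);
* nonvanishing planar Jacobian for small displacement on `-π/4 ≤ ψ ≤ π - arctan (1/3)`
  (`exists_jac_pathShell`), and injectivity there (`exists_injOn_pathShell`).

The tube about the path of Gompf's disc is then `pathTubeMap (pathShell R₀)`
(`FishtailPathTube.lean`), and the tube about the collar annulus `shellTubeMap (pathShell ρ_A)`
(`FishtailTubeALocal.lean`). Everything is proved; no named facts.

## References

* R. E. Gompf, *More Cappell–Shaneson spheres are standard*, Algebr. Geom. Topol. 10 (2010)
  1665–1681, proof of Thm 2.1 and Lemma 2.2. [GompfAGT2010]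
-/

noncomputable section

open scoped Real ContDiff Topology
open Set Function Filter

namespace Literature.Topology.FourManifolds

/-! ### Trigonometric preliminaries -/

section Trig

/-- `arctan (1/2) < π/6` (as `1/2 < tan (π/6) = 1/√3`). [folklore] -/
theorem arctan_half_lt_pi_div_six : Real.arctan (1 / 2) < π / 6 := by
  have h3 : Real.sqrt 3 < 2 := by
    rw [show (2 : ℝ) = Real.sqrt 4 by rw [show (4 : ℝ) = 2 ^ 2 by norm_num, Real.sqrt_sq (by norm_num)]]
    exact Real.sqrt_lt_sqrt (by norm_num) (by norm_num)
  have ht : (1 : ℝ) / 2 < Real.tan (π / 6) := by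
    rw [Real.tan_pi_div_six, div_lt_div_iff₀ (by norm_num) (Real.sqrt_pos.2 (by norm_num))]
    linarith
  have hπ := Real.pi_pos
  calc Real.arctan (1 / 2) < Real.arctan (Real.tan (π / 6)) := Real.arctan_strictMono ht
    _ = π / 6 := Real.arctan_tan (by linarith) (by linarith)

/-- `π/3 < arctan 2` (as `tan (π/3) = √3 < 2`). [folklore] -/
theorem pi_div_three_lt_arctan_two : π / 3 < Real.arctan 2 := by
  have h3 : Real.sqrt 3 < 2 := by
    rw [show (2 : ℝ) = Real.sqrt 4 by rw [show (4 : ℝ) = 2 ^ 2 by norm_num, Real.sqrt_sq (by norm_num)]]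
    exact Real.sqrt_lt_sqrt (by norm_num) (by norm_num)
  have hπ := Real.pi_pos
  calc π / 3 = Real.arctan (Real.tan (π / 3)) := (Real.arctan_tan (by linarith) (by linarith)).symm
    _ < Real.arctan 2 := Real.arctan_strictMono (by rw [Real.tan_pi_div_three]; exact h3)

/-- `0 < arctan (1/2)`. [folklore] -/
theorem arctan_half_pos : 0 < Real.arctan (1 / 2) := Real.arctan_pos.2 (by norm_num)

/-- For `0 < φ < π/2`: `cos (π - φ) / sin (π - φ) = -(1 / tan φ)`. [folklore] -/
theorem cos_div_sin_pi_sub (φ : ℝ) : Real.cos (π - φ) / Real.sin (π - φ) = -(1 / Real.tan φ) := by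
  rw [Real.cos_pi_sub, Real.sin_pi_sub, Real.tan_eq_sin_div_cos]
  rw [one_div_div, neg_div]

/-- `tan` is monotone on `(-π/2, π/2)`. [folklore] -/
theorem tan_le_tan_of_le {x y : ℝ} (hx : -(π / 2) < x) (hxy : x ≤ y) (hy : y < π / 2) : Real.tan x ≤ Real.tan y :=
  Real.strictMonoOn_tan.monotoneOn ⟨hx, by linarith⟩ ⟨by linarith, hy⟩ hxy

end Trig

/-! ### The unified shell -/

section Shell

variable (ρ : ℝ)

/-- The first cut angle `ψ₁ = (arctan (1/2) + π/6)/2`. [folklore] -/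
def psiCut : ℝ := (Real.arctan (1 / 2) + π / 6) / 2

/-- `arctan (1/2) < ψ₁ < π/6`. [folklore] -/
theorem psiCut_mem : Real.arctan (1 / 2) < psiCut ∧ psiCut < π / 6 := by
  have h := arctan_half_lt_pi_div_six
  unfold psiCut
  constructor <;> linarith

/-- The bottom-line abscissa at polar angle `ψ`: `u₀ = 3ρ - ρ tan ψ`. [folklore] -/
def flatU (ψ : ℝ) : ℝ := 3 * ρ - ρ * Real.tan ψ

/-- The vertical-line ordinate at polar angle `ψ`: `y = ρ - ρ cos ψ / sin ψ`. [folklore] -/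
def footY (ψ : ℝ) : ℝ := ρ - ρ * (Real.cos ψ / Real.sin ψ)

/-- **The unified planar shell along the path.** [folklore] -/
def pathShell (q : ℝ × ℝ) : ℝ × ℝ :=
  if q.1 ≤ psiCut then flatPt ρ (flatU ρ q.1) q.2
  else if q.1 ≤ π / 2 then bendPt ρ q.1 q.2 else footPt ρ (footY ρ q.1) q.2

variable {ρ} (hρ : 0 < ρ)
include hρ

/-- `u₀(ψ) ≤ 5ρ/2` iff `tan ψ ≥ 1/2`; here from `arctan (1/2) ≤ ψ < π/2`. [folklore] -/
theorem flatU_le {ψ : ℝ} (h1 : Real.arctan (1 / 2) ≤ ψ) (h2 : ψ < π / 2) : flatU ρ ψ ≤ 5 * ρ / 2 := by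
  have ht : 1 / 2 ≤ Real.tan ψ := by
    have := tan_le_tan_of_le (Real.neg_pi_div_two_lt_arctan _) h1 h2
    rwa [Real.tan_arctan] at this
  unfold flatU
  nlinarith

/-- `y(ψ) ≤ 3ρ/2` iff `cos ψ / sin ψ ≥ -1/2`; here from `0 < ψ ≤ π - arctan 2`. [folklore] -/
theorem footY_le {ψ : ℝ} (h1 : 0 < ψ) (h2 : ψ ≤ π - Real.arctan 2) : footY ρ ψ ≤ 3 * ρ / 2 := by
  -- write `ψ = π - φ`, `φ ∈ [arctan 2, π)`; `cos ψ / sin ψ = -1/tan φ ≥ -1/2` needs `tan φ ≥ 2`… for `φ < π/2`;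
  -- for `φ ≥ π/2` (`ψ ≤ π/2`) we have `cos ψ ≥ 0`, `sin ψ > 0` directly.
  unfold footY
  have hπ := Real.pi_pos
  have hs : 0 < Real.sin ψ := Real.sin_pos_of_pos_of_lt_pi h1 (by linarith [Real.arctan_pos.2 (show (0:ℝ) < 2 by norm_num)])
  rcases le_or_gt ψ (π / 2) with hle | hgt
  · have hc : 0 ≤ Real.cos ψ := Real.cos_nonneg_of_mem_Icc ⟨by linarith, hle⟩
    have : 0 ≤ Real.cos ψ / Real.sin ψ := div_nonneg hc hs.le
    nlinarith
  · set φ := π - ψ with hφ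
    have hφ1 : Real.arctan 2 ≤ φ := by linarith
    have hφ2 : φ < π / 2 := by linarith
    have hφ0 : -(π / 2) < φ := by linarith [Real.arctan_pos.2 (show (0:ℝ) < 2 by norm_num)]
    have ht : 2 ≤ Real.tan φ := by
      have := tan_le_tan_of_le (Real.neg_pi_div_two_lt_arctan _) hφ1 hφ2
      rwa [Real.tan_arctan] at this
    have hψ : ψ = π - φ := by rw [hφ]; ring
    rw [hψ, cos_div_sin_pi_sub]
    have : 1 / Real.tan φ ≤ 1 / 2 := by
      rw [div_le_div_iff₀ (by linarith) (by norm_num)]; linarith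
    nlinarith

/-- **On `ψ < π/6` the unified shell is the flat shell.** [folklore] -/
theorem pathShell_eq_flat {q : ℝ × ℝ} (h : q.1 < π / 6) : pathShell ρ q = flatPt ρ (flatU ρ q.1) q.2 := by
  unfold pathShell
  split_ifs with h1 h2
  · rfl
  · -- `ψ₁ < ψ < π/6`: the bend shell is the flat shell there
    have hm := psiCut_mem
    have hψ0 : -(π / 6) < q.1 := by linarith [arctan_half_pos]
    exact (flatPt_eq_bendPt hρ hψ0 h.le (flatU_le hρ (by linarith) (by linarith [Real.pi_pos])) q.2).symm
  · exfalso; linarith [Real.pi_pos]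

/-- **On `arctan (1/2) < ψ ≤ π - arctan 2` the unified shell is the bend shell.** [folklore] -/
theorem pathShell_eq_bend {q : ℝ × ℝ} (h1 : Real.arctan (1 / 2) < q.1) (h2 : q.1 ≤ π - Real.arctan 2) :
    pathShell ρ q = bendPt ρ q.1 q.2 := by
  have hm := psiCut_mem
  have hπ := Real.pi_pos
  have hA2 := pi_div_three_lt_arctan_two
  unfold pathShell
  split_ifs with h3 h4
  · have hψ0 : -(π / 6) < q.1 := by linarith [arctan_half_pos]
    exact flatPt_eq_bendPt hρ hψ0 (by linarith) (flatU_le hρ h1.le (by linarith)) q.2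
  · rfl
  · rw [not_le] at h3 h4
    exact footPt_eq_bendPt hρ (by linarith) (by linarith) (footY_le hρ (by linarith) h2) q.2

/-- **On `π/3 < ψ` the unified shell is the foot shell.** [folklore] -/
theorem pathShell_eq_foot {q : ℝ × ℝ} (h : π / 3 < q.1) : pathShell ρ q = footPt ρ (footY ρ q.1) q.2 := by
  have hm := psiCut_mem
  have hπ := Real.pi_pos
  have hA2 := pi_div_three_lt_arctan_two
  unfold pathShell
  split_ifs with h3 h4
  · exfalso; linarith
  · have h2' : q.1 ≤ π - Real.arctan 2 := by linarith [Real.arctan_lt_pi_div_two (2 : ℝ)]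
    exact (footPt_eq_bendPt hρ h.le (by linarith) (footY_le hρ (by linarith) h2') q.2).symm
  · rfl

/-! #### Smoothness -/

omit hρ in
/-- Smoothness of `u₀(ψ)` for `cos ψ ≠ 0`. [folklore] -/
theorem contDiffAt_flatU {ψ : ℝ} (h : Real.cos ψ ≠ 0) : ContDiffAt ℝ ∞ (flatU ρ) ψ :=
  contDiffAt_const.sub (contDiffAt_const.mul (Real.contDiffAt_tan.2 h))

omit hρ in
/-- Smoothness of `y(ψ)` for `sin ψ ≠ 0`. [folklore] -/
theorem contDiffAt_footY {ψ : ℝ} (h : Real.sin ψ ≠ 0) : ContDiffAt ℝ ∞ (footY ρ) ψ :=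
  contDiffAt_const.sub (contDiffAt_const.mul
    ((Real.contDiff_cos.contDiffAt).div (Real.contDiff_sin.contDiffAt) h))

/-- The flat branch is smooth for `cos ψ ≠ 0`. [folklore] -/
theorem contDiffAt_flatBranch {q : ℝ × ℝ} (h : Real.cos q.1 ≠ 0) :
    ContDiffAt ℝ ∞ (fun q : ℝ × ℝ ↦ flatPt ρ (flatU ρ q.1) q.2) q :=
  (contDiff_flatPt hρ).contDiffAt.comp q (((contDiffAt_flatU (ρ := ρ) h).comp q contDiffAt_fst).prodMk contDiffAt_snd)

/-- The foot branch is smooth for `sin ψ ≠ 0`. [folklore] -/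
theorem contDiffAt_footBranch {q : ℝ × ℝ} (h : Real.sin q.1 ≠ 0) :
    ContDiffAt ℝ ∞ (fun q : ℝ × ℝ ↦ footPt ρ (footY ρ q.1) q.2) q :=
  (contDiff_footPt hρ).contDiffAt.comp q (((contDiffAt_footY (ρ := ρ) h).comp q contDiffAt_fst).prodMk contDiffAt_snd)

/-- **The unified shell is smooth on `-π/2 < ψ < π`.** [folklore] -/
theorem contDiffAt_pathShell {q : ℝ × ℝ} (h1 : -(π / 2) < q.1) (h2 : q.1 < π) : ContDiffAt ℝ ∞ (pathShell ρ) q := by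
  have hπ := Real.pi_pos
  have hA2 := pi_div_three_lt_arctan_two
  have hAh := arctan_half_lt_pi_div_six
  rcases lt_or_ge q.1 (π / 6) with hlt | hge
  · -- flat branch on the open set `{ψ < π/6}`
    have hc : Real.cos q.1 ≠ 0 := (Real.cos_pos_of_mem_Ioo ⟨h1, by linarith⟩).ne'
    refine (contDiffAt_flatBranch hρ hc).congr_of_eventuallyEq ?_
    have ho : IsOpen {q : ℝ × ℝ | q.1 < π / 6} := isOpen_lt continuous_fst continuous_const
    exact Filter.eventuallyEq_of_mem (ho.mem_nhds hlt) fun q' hq' ↦ pathShell_eq_flat hρ hq'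
  rcases lt_or_ge (π / 3) q.1 with hgt | hle
  · -- foot branch on the open set `{π/3 < ψ < π}`
    have hs : Real.sin q.1 ≠ 0 := (Real.sin_pos_of_pos_of_lt_pi (by linarith) h2).ne'
    refine (contDiffAt_footBranch hρ hs).congr_of_eventuallyEq ?_
    have ho : IsOpen {q : ℝ × ℝ | π / 3 < q.1} := isOpen_lt continuous_const continuous_fst
    exact Filter.eventuallyEq_of_mem (ho.mem_nhds hgt) fun q' hq' ↦ pathShell_eq_foot hρ hq'
  · -- bend branch on the open set `{arctan (1/2) < ψ < π - arctan 2}`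
    refine (contDiffAt_bendPt (ρ := ρ) (q := q) (by linarith [arctan_half_pos]) (by linarith)).congr_of_eventuallyEq ?_
    have ho : IsOpen {q : ℝ × ℝ | Real.arctan (1 / 2) < q.1 ∧ q.1 < π - Real.arctan 2} :=
      (isOpen_lt continuous_const continuous_fst).inter (isOpen_lt continuous_fst continuous_const)
    have hA2' := Real.arctan_lt_pi_div_two (2 : ℝ)
    exact Filter.eventuallyEq_of_mem (ho.mem_nhds ⟨by linarith, by linarith⟩)
      fun q' hq' ↦ pathShell_eq_bend hρ hq'.1 hq'.2.le

/-! #### Partial derivatives and the planar Jacobian -/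

/-- **Nonvanishing planar Jacobian of the unified shell** for small displacement on
`-π/4 ≤ ψ ≤ π - arctan (1/3)`: there is `δ > 0` such that for `|a| < δ` the partials
`u = ∂_ψ`, `v = ∂_a` of the shell satisfy `u.1 v.2 - u.2 v.1 ≠ 0`. [folklore] -/
theorem exists_jac_pathShell : ∃ δ > 0, ∀ q : ℝ × ℝ, -(π / 4) ≤ q.1 → q.1 ≤ π - Real.arctan (1 / 3) → |q.2| < δ →
    ∃ u v : ℝ × ℝ, HasDerivAt (fun x ↦ pathShell ρ (x, q.2)) u q.1 ∧ HasDerivAt (fun a ↦ pathShell ρ (q.1, a)) v q.2 ∧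
      u.1 * v.2 - u.2 * v.1 ≠ 0 := by
  obtain ⟨δ₁, hδ₁, hJ₁⟩ := exists_flatJac_pos hρ
  obtain ⟨δ₂, hδ₂, hJ₂⟩ := exists_footJac_neg hρ
  have hπ := Real.pi_pos
  have hA2 := pi_div_three_lt_arctan_two
  have hAh := arctan_half_lt_pi_div_six
  have hA3 : 0 < Real.arctan (1 / 3) := Real.arctan_pos.2 (by norm_num)
  refine ⟨min (min δ₁ δ₂) ρ, by positivity, fun q hq1 hq2 hqa ↦ ?_⟩
  have ha1 : |q.2| < δ₁ := lt_of_lt_of_le hqa ((min_le_left _ _).trans (min_le_left _ _))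
  have ha2 : |q.2| < δ₂ := lt_of_lt_of_le hqa ((min_le_left _ _).trans (min_le_right _ _))
  have haρ : |q.2| < ρ := lt_of_lt_of_le hqa (min_le_right _ _)
  rcases lt_or_ge q.1 (π / 6) with hlt | hge
  · -- flat regime
    have hc : 0 < Real.cos q.1 := Real.cos_pos_of_mem_Ioo ⟨by linarith, by linarith⟩
    have hU : HasDerivAt (flatU ρ) (-(ρ * (1 / Real.cos q.1 ^ 2))) q.1 := by
      unfold flatU
      simpa using ((Real.hasDerivAt_tan hc.ne').const_mul ρ).const_sub (3 * ρ)
    have hu₀ : flatU ρ q.1 ∈ Icc (2 * ρ) (4 * ρ) := by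
      have ht1 : Real.tan q.1 ≤ 1 := by
        have := tan_le_tan_of_le (x := q.1) (y := π / 4) (by linarith) (by linarith) (by linarith)
        rwa [Real.tan_pi_div_four] at this
      have ht2 : -1 ≤ Real.tan q.1 := by
        have := tan_le_tan_of_le (x := -(π / 4)) (y := q.1) (by linarith) hq1 (by linarith)
        rwa [Real.tan_neg, Real.tan_pi_div_four] at this
      unfold flatU
      constructor <;> nlinarith
    set uf : ℝ × ℝ := (1 + q.2 * deriv (flatPc ρ) (flatU ρ q.1), q.2 * deriv (flatKc ρ) (flatU ρ q.1)) with huf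
    set vf : ℝ × ℝ := (flatPc ρ (flatU ρ q.1), flatKc ρ (flatU ρ q.1)) with hvf
    have hFu : HasDerivAt (fun u ↦ flatPt ρ u q.2) uf (flatU ρ q.1) := hasDerivAt_flatPt_u hρ (flatU ρ q.1) q.2
    have hFa : HasDerivAt (fun a ↦ flatPt ρ (flatU ρ q.1) a) vf q.2 := hasDerivAt_flatPt_a (flatU ρ q.1) q.2
    have hcomp : HasDerivAt (fun x ↦ flatPt ρ (flatU ρ x) q.2) ((-(ρ * (1 / Real.cos q.1 ^ 2))) • uf) q.1 :=
      hFu.scomp q.1 hU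
    refine ⟨(-(ρ * (1 / Real.cos q.1 ^ 2))) • uf, vf, ?_, ?_, ?_⟩
    · refine hcomp.congr_of_eventuallyEq ?_
      have ho : IsOpen {x : ℝ | x < π / 6} := isOpen_gt' _
      exact Filter.eventuallyEq_of_mem (ho.mem_nhds hlt) fun x hx ↦ pathShell_eq_flat hρ (q := (x, q.2)) hx
    · refine hFa.congr_of_eventuallyEq (Eventually.of_forall fun a ↦ ?_)
      exact pathShell_eq_flat hρ (q := (q.1, a)) hlt
    · have hJ := hJ₁ (flatU ρ q.1) hu₀ q.2 ha1
      simp only [huf, hvf, Prod.smul_mk, smul_eq_mul]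
      have hneg : -(ρ * (1 / Real.cos q.1 ^ 2)) ≠ 0 := by
        have : 0 < ρ * (1 / Real.cos q.1 ^ 2) := by positivity
        linarith
      rw [show -(ρ * (1 / Real.cos q.1 ^ 2)) * (1 + q.2 * deriv (flatPc ρ) (flatU ρ q.1)) * flatKc ρ (flatU ρ q.1) -
          -(ρ * (1 / Real.cos q.1 ^ 2)) * (q.2 * deriv (flatKc ρ) (flatU ρ q.1)) * flatPc ρ (flatU ρ q.1) =
          -(ρ * (1 / Real.cos q.1 ^ 2)) * ((1 + q.2 * deriv (flatPc ρ) (flatU ρ q.1)) * flatKc ρ (flatU ρ q.1) -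
            q.2 * deriv (flatKc ρ) (flatU ρ q.1) * flatPc ρ (flatU ρ q.1)) by ring]
      exact mul_ne_zero hneg hJ.ne'
  rcases lt_or_ge q.1 (π - Real.arctan 2) with hlt2 | hge2
  · -- bend regime (`π/6 ≤ ψ < π - arctan 2 < 2π/3`)
    have h1' : -(π / 6) < q.1 := by linarith
    have h2' : q.1 < 2 * π / 3 := by linarith
    have hJb := bendJac (ρ := ρ) q.1 q.2
    simp only at hJb
    refine ⟨(-(deriv (bendR ρ) q.1 * Real.sin q.1) - (bendR ρ q.1 - q.2) * Real.cos q.1,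
        -(deriv (bendR ρ) q.1 * Real.cos q.1) + (bendR ρ q.1 - q.2) * Real.sin q.1),
      (Real.sin q.1, Real.cos q.1), ?_, ?_, by rw [hJb]; exact bendJac_ne_zero hρ h1' h2' haρ⟩
    · refine (hasDerivAt_bendPt_psi (ρ := ρ) h1' h2' q.2).congr_of_eventuallyEq ?_
      have ho : IsOpen {x : ℝ | Real.arctan (1 / 2) < x ∧ x < π - Real.arctan 2} := isOpen_Ioo
      exact Filter.eventuallyEq_of_mem (ho.mem_nhds ⟨by linarith, hlt2⟩)
        fun x hx ↦ pathShell_eq_bend hρ (q := (x, q.2)) hx.1 hx.2.le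
    · refine (hasDerivAt_bendPt_a (ρ := ρ) q.1 q.2).congr_of_eventuallyEq (Eventually.of_forall fun a ↦ ?_)
      exact pathShell_eq_bend hρ (q := (q.1, a)) (by linarith) hlt2.le
  · -- foot regime (`π - arctan 2 ≤ ψ ≤ π - arctan (1/3)`)
    have hs : 0 < Real.sin q.1 := Real.sin_pos_of_pos_of_lt_pi (by linarith) (by linarith)
    have hY : HasDerivAt (footY ρ) (ρ * (1 / Real.sin q.1 ^ 2)) q.1 := by
      have h := (Real.hasDerivAt_cos q.1).div (Real.hasDerivAt_sin q.1) hs.ne'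
      have h' : HasDerivAt (fun x ↦ ρ - ρ * (Real.cos x / Real.sin x))
          (-(ρ * ((-Real.sin q.1 * Real.sin q.1 - Real.cos q.1 * Real.cos q.1) / Real.sin q.1 ^ 2))) q.1 :=
        (h.const_mul ρ).const_sub ρ
      refine h'.congr_deriv ?_
      have key : -Real.sin q.1 * Real.sin q.1 - Real.cos q.1 * Real.cos q.1 = -1 := by
        linear_combination (-1 : ℝ) * Real.sin_sq_add_cos_sq q.1
      rw [key]
      ring
    -- `y(ψ) ∈ [3ρ/2, 4ρ]`
    have hy : footY ρ q.1 ∈ Icc (6 * ρ / 5) (4 * ρ) := by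
      set φ := π - q.1 with hφ
      have hφ1 : Real.arctan (1 / 3) ≤ φ := by linarith
      have hφ2 : φ ≤ Real.arctan 2 := by linarith
      have hφlt : φ < π / 2 := lt_of_le_of_lt hφ2 (Real.arctan_lt_pi_div_two _)
      have hφgt : -(π / 2) < φ := by linarith
      have ht1 : 1 / 3 ≤ Real.tan φ := by
        have := tan_le_tan_of_le (Real.neg_pi_div_two_lt_arctan _) hφ1 hφlt
        rwa [Real.tan_arctan] at this
      have ht2 : Real.tan φ ≤ 2 := by
        have := tan_le_tan_of_le hφgt hφ2 (Real.arctan_lt_pi_div_two _)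
        rwa [Real.tan_arctan] at this
      have htpos : 0 < Real.tan φ := by linarith
      have hψ : q.1 = π - φ := by rw [hφ]; ring
      rw [footY, hψ, cos_div_sin_pi_sub]
      have h1 : 1 / Real.tan φ ≤ 3 := by rw [div_le_iff₀ htpos]; linarith
      have h2 : 1 / 2 ≤ 1 / Real.tan φ := by rw [div_le_div_iff₀ (by norm_num) htpos]; linarith
      constructor <;> nlinarith
    set uf : ℝ × ℝ := (q.2 * deriv (footKc ρ) (footY ρ q.1), 1 + q.2 * deriv (footPc ρ) (footY ρ q.1)) with huf
    set vf : ℝ × ℝ := (footKc ρ (footY ρ q.1), footPc ρ (footY ρ q.1)) with hvf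
    have hFu : HasDerivAt (fun y ↦ footPt ρ y q.2) uf (footY ρ q.1) := hasDerivAt_footPt_y hρ (footY ρ q.1) q.2
    have hFa : HasDerivAt (fun a ↦ footPt ρ (footY ρ q.1) a) vf q.2 := hasDerivAt_footPt_a (footY ρ q.1) q.2
    have hcomp : HasDerivAt (fun x ↦ footPt ρ (footY ρ x) q.2) ((ρ * (1 / Real.sin q.1 ^ 2)) • uf) q.1 :=
      hFu.scomp q.1 hY
    refine ⟨(ρ * (1 / Real.sin q.1 ^ 2)) • uf, vf, ?_, ?_, ?_⟩
    · refine hcomp.congr_of_eventuallyEq ?_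
      have ho : IsOpen {x : ℝ | π / 3 < x} := isOpen_lt' _
      have hA2' := Real.arctan_lt_pi_div_two (2 : ℝ)
      exact Filter.eventuallyEq_of_mem (ho.mem_nhds (show π / 3 < q.1 by linarith))
        fun x hx ↦ pathShell_eq_foot hρ (q := (x, q.2)) hx
    · have hA2' := Real.arctan_lt_pi_div_two (2 : ℝ)
      refine hFa.congr_of_eventuallyEq (Eventually.of_forall fun a ↦ ?_)
      exact pathShell_eq_foot hρ (q := (q.1, a)) (show π / 3 < q.1 by linarith)
    · have hJ := hJ₂ (footY ρ q.1) hy q.2 ha2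
      simp only [huf, hvf, Prod.smul_mk, smul_eq_mul]
      have hpos : 0 < ρ * (1 / Real.sin q.1 ^ 2) := by positivity
      rw [show ρ * (1 / Real.sin q.1 ^ 2) * (q.2 * deriv (footKc ρ) (footY ρ q.1)) * footPc ρ (footY ρ q.1) -
          ρ * (1 / Real.sin q.1 ^ 2) * (1 + q.2 * deriv (footPc ρ) (footY ρ q.1)) * footKc ρ (footY ρ q.1) =
          ρ * (1 / Real.sin q.1 ^ 2) * (q.2 * deriv (footKc ρ) (footY ρ q.1) * footPc ρ (footY ρ q.1) -
            (1 + q.2 * deriv (footPc ρ) (footY ρ q.1)) * footKc ρ (footY ρ q.1)) by ring]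
      exact mul_ne_zero hpos.ne' hJ.ne

/-! #### Injectivity -/

/-- Injectivity of the foot shell on `[0, 4ρ] × [-δ, δ]` (extending `exists_injOn_footPt`). [folklore] -/
theorem exists_injOn_footPt' : ∃ δ > 0, InjOn (fun q : ℝ × ℝ ↦ footPt ρ q.1 q.2) (Icc 0 (4 * ρ) ×ˢ Icc (-δ) δ) := by
  have hk : ∀ x ∈ Icc (0 : ℝ) (4 * ρ), 1 / 2 ≤ footKc ρ x := fun x hx ↦ by
    rcases le_or_gt x (2 * ρ) with hle | hgt
    · exact half_le_footKc hρ (abs_le.2 ⟨by linarith, by linarith [hx.1]⟩)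
    · rw [footKc, footM_of_ge hgt.le hρ]; norm_num
  obtain ⟨δ, hδ, hinj⟩ := exists_injOn_interp (p := footPc ρ) (k := footKc ρ) (a := 0) (b := 4 * ρ)
    (k₀ := 1 / 2) (by norm_num) (fun x _ ↦ (contDiff_footPc hρ).contDiffAt.of_le (by norm_num))
    (fun x _ ↦ (contDiff_footKc hρ).contDiffAt.of_le (by norm_num)) hk
  refine ⟨δ, hδ, fun q hq q' hq' h ↦ ?_⟩
  simp only [footPt, Prod.mk.injEq] at h
  exact hinj hq hq' (by rw [Prod.mk.injEq]; exact ⟨h.2, by linarith [h.1]⟩)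

/-- For `π/6 < ψ < 2π/3`: `ρ tan (π/6) ≤ R(ψ) sin ψ`. [folklore] -/
theorem bendR_mul_sin_ge {ψ : ℝ} (h1 : π / 6 < ψ) (h2 : ψ < 2 * π / 3) :
    ρ * Real.tan (π / 6) ≤ bendR ρ ψ * Real.sin ψ := by
  have hπ := Real.pi_pos
  have hs : 0 < Real.sin ψ := sin_pos_of_mem (by linarith) h2
  have ht6 : Real.tan (π / 6) < 1 := by
    rw [Real.tan_pi_div_six, div_lt_one (Real.sqrt_pos.2 (by norm_num))]
    rw [show (1 : ℝ) = Real.sqrt 1 from Real.sqrt_one.symm]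
    exact Real.sqrt_lt_sqrt (by norm_num) (by norm_num)
  rcases le_or_gt (π / 3) ψ with hge | hlt
  · rw [bendR_of_ge hge, div_mul_cancel₀ _ hs.ne']
    nlinarith
  · have hc : 0 < Real.cos ψ := cos_pos_of_mem (by linarith) (by linarith)
    have hB := bendB_mem ψ
    have htan : Real.tan (π / 6) ≤ Real.tan ψ := tan_le_tan_of_le (by linarith) h1.le (by linarith)
    rw [bendR]
    have e : ((1 - bendB ψ) * (ρ / Real.cos ψ) + bendB ψ * (ρ / Real.sin ψ)) * Real.sin ψ =
        (1 - bendB ψ) * (ρ * Real.tan ψ) + bendB ψ * ρ := by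
      rw [Real.tan_eq_sin_div_cos]; field_simp
    rw [e]
    have h1 : (1 - bendB ψ) * (ρ * Real.tan (π / 6)) ≤ (1 - bendB ψ) * (ρ * Real.tan ψ) :=
      mul_le_mul_of_nonneg_left (mul_le_mul_of_nonneg_left htan hρ.le) (by linarith [hB.2])
    have h2 : bendB ψ * (ρ * Real.tan (π / 6)) ≤ bendB ψ * ρ :=
      mul_le_mul_of_nonneg_left (by nlinarith) hB.1
    have e2 : ρ * Real.tan (π / 6) = (1 - bendB ψ) * (ρ * Real.tan (π / 6)) + bendB ψ * (ρ * Real.tan (π / 6)) := by ring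
    linarith

omit hρ in
/-- `tan` determines the angle on `(-π/2, π/2)`: equal `u₀(ψ)` gives equal `ψ` (for `ρ ≠ 0`). [folklore] -/
theorem eq_of_flatU_eq (hρ0 : ρ ≠ 0) {x y : ℝ} (hx : x ∈ Ioo (-(π / 2)) (π / 2)) (hy : y ∈ Ioo (-(π / 2)) (π / 2))
    (h : flatU ρ x = flatU ρ y) : x = y := by
  have ht : Real.tan x = Real.tan y := by
    unfold flatU at h
    exact mul_left_cancel₀ hρ0 (by linarith)
  exact Real.injOn_tan hx hy ht

omit hρ in
/-- `cos/sin` determines the angle on `(0, π)`: equal `y(ψ)` gives equal `ψ` (for `ρ ≠ 0`). [folklore] -/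
theorem eq_of_footY_eq (hρ0 : ρ ≠ 0) {x y : ℝ} (hx : x ∈ Ioo 0 π) (hy : y ∈ Ioo 0 π)
    (h : footY ρ x = footY ρ y) : x = y := by
  have hsx : 0 < Real.sin x := Real.sin_pos_of_pos_of_lt_pi hx.1 hx.2
  have hsy : 0 < Real.sin y := Real.sin_pos_of_pos_of_lt_pi hy.1 hy.2
  have hq : Real.cos x / Real.sin x = Real.cos y / Real.sin y := by
    unfold footY at h
    exact mul_left_cancel₀ hρ0 (by linarith)
  rw [div_eq_div_iff hsx.ne' hsy.ne'] at hq
  have hsin : Real.sin (y - x) = 0 := by rw [Real.sin_sub]; linarith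
  have h0 := (Real.sin_eq_zero_iff_of_lt_of_lt (by linarith [hx.2, hy.1]) (by linarith [hx.1, hy.2])).1 hsin
  linarith

/-- `y(ψ) ≥ 3ρ/2` for `π - arctan 2 ≤ ψ < π`. [folklore] -/
theorem footY_ge {ψ : ℝ} (h1 : π - Real.arctan 2 ≤ ψ) (h2 : ψ < π) : 3 * ρ / 2 ≤ footY ρ ψ := by
  have hπ := Real.pi_pos
  set φ := π - ψ with hφ
  have hφ0 : 0 < φ := by linarith
  have hφ2 : φ ≤ Real.arctan 2 := by linarith
  have hφlt : φ < π / 2 := lt_of_le_of_lt hφ2 (Real.arctan_lt_pi_div_two _)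
  have ht2 : Real.tan φ ≤ 2 := by
    have := tan_le_tan_of_le (by linarith) hφ2 (Real.arctan_lt_pi_div_two _)
    rwa [Real.tan_arctan] at this
  have htpos : 0 < Real.tan φ := Real.tan_pos_of_pos_of_lt_pi_div_two hφ0 hφlt
  have hψ : ψ = π - φ := by rw [hφ]; ring
  rw [footY, hψ, cos_div_sin_pi_sub]
  have : 1 / 2 ≤ 1 / Real.tan φ := by rw [div_le_div_iff₀ (by norm_num) htpos]; linarith
  nlinarith

/-- `0 ≤ k_c ≤ 1` for the flat shell. [folklore] -/
theorem flatKc_nonneg (u₀ : ℝ) : 0 ≤ flatKc ρ u₀ := by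
  have hM := flatM_mem (ρ := ρ) u₀
  have hQ : 0 ≤ flatQ ρ u₀ := div_nonneg hρ.le (flatD_pos hρ u₀).le
  unfold flatKc
  nlinarith [hM.1, hM.2]

/-- `u₀(ψ) ∈ [2ρ, 4ρ]` for `ψ ∈ [-π/4, π/4]`. [folklore] -/
theorem flatU_mem {x : ℝ} (hx1 : -(π / 4) ≤ x) (hx2 : x ≤ π / 4) : flatU ρ x ∈ Icc (2 * ρ) (4 * ρ) := by
  have hπ := Real.pi_pos
  have ht1 : Real.tan x ≤ 1 := by
    have := tan_le_tan_of_le (x := x) (y := π / 4) (by linarith) hx2 (by linarith)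
    rwa [Real.tan_pi_div_four] at this
  have ht2 : -1 ≤ Real.tan x := by
    have := tan_le_tan_of_le (x := -(π / 4)) (y := x) (by linarith) hx1 (by linarith)
    rwa [Real.tan_neg, Real.tan_pi_div_four] at this
  unfold flatU; constructor <;> nlinarith

/-- `y(ψ) ∈ [0, 4ρ]` for `ψ ∈ [π/3, π - arctan (1/3)]`. [folklore] -/
theorem footY_mem {x : ℝ} (hx1 : π / 3 ≤ x) (hx2 : x ≤ π - Real.arctan (1 / 3)) : footY ρ x ∈ Icc 0 (4 * ρ) := by
  have hπ := Real.pi_pos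
  have hA3 : 0 < Real.arctan (1 / 3) := Real.arctan_pos.2 (by norm_num)
  have hsx : 0 < Real.sin x := Real.sin_pos_of_pos_of_lt_pi (by linarith) (by linarith)
  rcases le_or_gt x (π / 2) with hle | hgt
  · have hcx : 0 ≤ Real.cos x := Real.cos_nonneg_of_mem_Icc ⟨by linarith, hle⟩
    have hcs : Real.cos x ≤ Real.sin x := by
      have h1 : Real.cos x ≤ 1 / 2 := by
        rw [← Real.cos_pi_div_three]
        exact Real.cos_le_cos_of_nonneg_of_le_pi (by linarith) (by linarith) hx1
      have h2 : 1 / 2 ≤ Real.sin x := half_le_sin (by linarith) (by linarith)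
      linarith
    have hq : Real.cos x / Real.sin x ≤ 1 := (div_le_one hsx).2 hcs
    have hq0 : 0 ≤ Real.cos x / Real.sin x := div_nonneg hcx hsx.le
    unfold footY; constructor <;> nlinarith
  · have hφ1 : Real.arctan (1 / 3) ≤ π - x := by linarith
    have hφlt : π - x < π / 2 := by linarith
    have ht1 : 1 / 3 ≤ Real.tan (π - x) := by
      have := tan_le_tan_of_le (Real.neg_pi_div_two_lt_arctan _) hφ1 hφlt
      rwa [Real.tan_arctan] at this
    have htpos : 0 < Real.tan (π - x) := by linarith
    have hx' : x = π - (π - x) := by ring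
    rw [footY, hx', cos_div_sin_pi_sub]
    have h1 : 1 / Real.tan (π - x) ≤ 3 := by rw [div_le_iff₀ htpos]; linarith
    have h2 : 0 ≤ 1 / Real.tan (π - x) := by positivity
    constructor <;> nlinarith

/-- Flat regime: `X ≥ 3ρ - ρ tan ψ₁ - |b|`. [folklore] -/
theorem flat_fst_ge {x b : ℝ} (hx1 : -(π / 4) ≤ x) (hx2 : x ≤ psiCut) :
    3 * ρ - ρ * Real.tan psiCut - |b| ≤ (flatPt ρ (flatU ρ x) b).1 := by
  have hπ := Real.pi_pos
  have hm := psiCut_mem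
  have hAh := arctan_half_lt_pi_div_six
  have ht : Real.tan x ≤ Real.tan psiCut := tan_le_tan_of_le (by linarith) hx2 (by linarith)
  have hp := abs_flatPc_le hρ (flatU ρ x)
  have hbp : -|b| ≤ b * flatPc ρ (flatU ρ x) := by
    have h := abs_mul b (flatPc ρ (flatU ρ x))
    have h' : |b| * |flatPc ρ (flatU ρ x)| ≤ |b| := by nlinarith [abs_nonneg b]
    linarith [neg_abs_le (b * flatPc ρ (flatU ρ x))]
  have hU : 3 * ρ - ρ * Real.tan psiCut ≤ flatU ρ x := by
    unfold flatU; nlinarith [mul_le_mul_of_nonneg_left ht hρ.le]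
  show 3 * ρ - ρ * Real.tan psiCut - |b| ≤ flatU ρ x + b * flatPc ρ (flatU ρ x)
  linarith

/-- Bend regime past `π/6`: `X ≤ 3ρ - ρ tan (π/6) + |b|`. [folklore] -/
theorem bend_fst_le {x b : ℝ} (hx1 : π / 6 < x) (hx2 : x < 2 * π / 3) :
    (bendPt ρ x b).1 ≤ 3 * ρ - ρ * Real.tan (π / 6) + |b| := by
  have hπ := Real.pi_pos
  have hs : 0 < Real.sin x := sin_pos_of_mem (by linarith) hx2
  have hR := bendR_mul_sin_ge hρ hx1 hx2
  have hb' : b * Real.sin x ≤ |b| := by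
    have h1 : b * Real.sin x ≤ |b| * Real.sin x := mul_le_mul_of_nonneg_right (le_abs_self b) hs.le
    nlinarith [abs_nonneg b, Real.sin_le_one x]
  show 3 * ρ - (bendR ρ x - b) * Real.sin x ≤ 3 * ρ - ρ * Real.tan (π / 6) + |b|
  nlinarith

/-- Flat regime: `|Y| ≤ |b|`. [folklore] -/
theorem flat_snd_abs_le (x b : ℝ) : |(flatPt ρ (flatU ρ x) b).2| ≤ |b| := by
  show |b * flatKc ρ (flatU ρ x)| ≤ |b|
  rw [abs_mul, abs_of_nonneg (flatKc_nonneg hρ _)]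
  nlinarith [abs_nonneg b, flatKc_le_one hρ (flatU ρ x), flatKc_nonneg hρ (flatU ρ x)]

/-- Low bend regime (`x < π/3`): `Y ≤ ρ/2 + |b|/2`. [folklore] -/
theorem bend_snd_le {x b : ℝ} (hx1 : 0 < x) (hx2 : x < π / 3) (hb : |b| < ρ) : (bendPt ρ x b).2 ≤ ρ / 2 + |b| / 2 := by
  have hπ := Real.pi_pos
  have hc : 1 / 2 ≤ Real.cos x := half_le_cos (by linarith) hx2.le
  have hR := (bendR_mem hρ (show -(π / 6) < x by linarith) (by linarith)).1
  have hRb : ρ - |b| ≤ bendR ρ x - b := by linarith [le_abs_self b]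
  have hpos : 0 ≤ bendR ρ x - b := by linarith [(abs_lt.1 hb).2]
  have hm : (ρ - |b|) * (1 / 2) ≤ (bendR ρ x - b) * Real.cos x := mul_le_mul hRb hc (by norm_num) hpos
  show ρ - (bendR ρ x - b) * Real.cos x ≤ ρ / 2 + |b| / 2
  linarith

/-- Foot regime: `Y ≥ 3ρ/2 - |b|`. [folklore] -/
theorem foot_snd_ge {x b : ℝ} (hx1 : π - Real.arctan 2 ≤ x) (hx2 : x < π) : 3 * ρ / 2 - |b| ≤ (footPt ρ (footY ρ x) b).2 := by
  have hY := footY_ge hρ hx1 hx2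
  have hp := abs_footPc_le hρ (footY ρ x)
  have hbp : -|b| ≤ b * footPc ρ (footY ρ x) := by
    have h := abs_mul b (footPc ρ (footY ρ x))
    have h' : |b| * |footPc ρ (footY ρ x)| ≤ |b| := by nlinarith [abs_nonneg b]
    linarith [neg_abs_le (b * footPc ρ (footY ρ x))]
  show 3 * ρ / 2 - |b| ≤ footY ρ x + b * footPc ρ (footY ρ x)
  linarith

omit hρ in
/-- The gap constant at the first cut is positive: `tan ψ₁ < tan (π/6)`. [folklore] -/
theorem tan_psiCut_lt : Real.tan psiCut < Real.tan (π / 6) := by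
  have hπ := Real.pi_pos
  have hm := psiCut_mem
  have hA0 := arctan_half_pos
  exact Real.strictMonoOn_tan ⟨by linarith, by linarith⟩ ⟨by linarith, by linarith⟩ hm.2

/-- **Injectivity of the unified shell** for small displacement on `-π/4 ≤ ψ ≤ π - arctan (1/3)`. [folklore] -/
theorem exists_injOn_pathShell : ∃ δ > 0, InjOn (pathShell ρ) (Icc (-(π / 4)) (π - Real.arctan (1 / 3)) ×ˢ Ioo (-δ) δ) := by
  obtain ⟨δ₁, hδ₁, hI₁⟩ := exists_injOn_flatPt hρ
  obtain ⟨δ₂, hδ₂, hI₂⟩ := exists_injOn_footPt' hρ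
  have hπ := Real.pi_pos
  have hA2 := pi_div_three_lt_arctan_two
  have hA2' := Real.arctan_lt_pi_div_two (2 : ℝ)
  have hAh := arctan_half_lt_pi_div_six
  have hA0 := arctan_half_pos
  have hA3 : 0 < Real.arctan (1 / 3) := Real.arctan_pos.2 (by norm_num)
  have hm := psiCut_mem
  have hgpos : 0 < ρ * (Real.tan (π / 6) - Real.tan psiCut) := mul_pos hρ (by linarith [tan_psiCut_lt])
  obtain ⟨δ, hδpos, hδ1, hδ2, hδg, hδρ⟩ : ∃ δ : ℝ, 0 < δ ∧ δ ≤ δ₁ ∧ δ ≤ δ₂ ∧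
      δ ≤ ρ * (Real.tan (π / 6) - Real.tan psiCut) / 4 ∧ δ ≤ ρ / 4 :=
    ⟨min (min δ₁ δ₂) (min (ρ * (Real.tan (π / 6) - Real.tan psiCut) / 4) (ρ / 4)), by positivity,
      (min_le_left _ _).trans (min_le_left _ _), (min_le_left _ _).trans (min_le_right _ _),
      (min_le_right _ _).trans (min_le_left _ _), (min_le_right _ _).trans (min_le_right _ _)⟩
  refine ⟨δ, hδpos, ?_⟩
  -- the ordered key statement
  have key : ∀ x b x' b', x ∈ Icc (-(π / 4)) (π - Real.arctan (1 / 3)) → b ∈ Ioo (-δ) δ →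
      x' ∈ Icc (-(π / 4)) (π - Real.arctan (1 / 3)) → b' ∈ Ioo (-δ) δ →
      pathShell ρ (x, b) = pathShell ρ (x', b') → x ≤ x' → (x, b) = (x', b') := by
    intro x b x' b' hx hb hx' hb' heq hle
    have hbI : b ∈ Icc (-δ₁) δ₁ := ⟨by linarith [hb.1], by linarith [hb.2]⟩
    have hbI' : b' ∈ Icc (-δ₁) δ₁ := ⟨by linarith [hb'.1], by linarith [hb'.2]⟩
    have hbJ : b ∈ Icc (-δ₂) δ₂ := ⟨by linarith [hb.1], by linarith [hb.2]⟩
    have hbJ' : b' ∈ Icc (-δ₂) δ₂ := ⟨by linarith [hb'.1], by linarith [hb'.2]⟩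
    have hbρ : |b| < ρ := abs_lt.2 ⟨by linarith [hb.1], by linarith [hb.2]⟩
    have hbρ' : |b'| < ρ := abs_lt.2 ⟨by linarith [hb'.1], by linarith [hb'.2]⟩
    have hbg : |b| < ρ * (Real.tan (π / 6) - Real.tan psiCut) / 4 := abs_lt.2 ⟨by linarith [hb.1], by linarith [hb.2]⟩
    have hbg' : |b'| < ρ * (Real.tan (π / 6) - Real.tan psiCut) / 4 := abs_lt.2 ⟨by linarith [hb'.1], by linarith [hb'.2]⟩
    have hb4 : |b| < ρ / 4 := abs_lt.2 ⟨by linarith [hb.1], by linarith [hb.2]⟩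
    have hb4' : |b'| < ρ / 4 := abs_lt.2 ⟨by linarith [hb'.1], by linarith [hb'.2]⟩
    rcases le_or_gt x' psiCut with hA' | hBC'
    · -- both flat
      rw [pathShell_eq_flat hρ (q := (x, b)) (show x < π / 6 by linarith),
        pathShell_eq_flat hρ (q := (x', b')) (show x' < π / 6 by linarith)] at heq
      have h := hI₁ (mk_mem_prod (flatU_mem hρ hx.1 (by linarith)) hbI) (mk_mem_prod (flatU_mem hρ hx'.1 (by linarith)) hbI') heq
      simp only [Prod.mk.injEq] at h
      have hxx := eq_of_flatU_eq hρ.ne' ⟨by linarith [hx.1], by linarith⟩ ⟨by linarith [hx'.1], by linarith⟩ h.1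
      rw [hxx, h.2]
    rcases le_or_gt x' (π - Real.arctan 2) with hB' | hC'
    · -- `x'` in the bend regime
      rw [pathShell_eq_bend hρ (q := (x', b')) (by simp only; linarith) hB'] at heq
      rcases le_or_gt x psiCut with hA | hB
      · rw [pathShell_eq_flat hρ (q := (x, b)) (show x < π / 6 by linarith)] at heq
        rcases le_or_gt x' (π / 6) with h6 | h6
        · -- the bend value is a flat value
          rw [← flatPt_eq_bendPt hρ (by linarith) h6 (flatU_le hρ (by linarith) (by linarith)) b'] at heq
          have h := hI₁ (mk_mem_prod (flatU_mem hρ hx.1 (by linarith)) hbI)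
            (mk_mem_prod (flatU_mem hρ hx'.1 (by linarith)) hbI') (show _ = flatPt ρ (flatU ρ x') b' from heq)
          simp only [Prod.mk.injEq] at h
          have hxx := eq_of_flatU_eq hρ.ne' ⟨by linarith [hx.1], by linarith⟩ ⟨by linarith [hx'.1], by linarith⟩ h.1
          rw [hxx, h.2]
        · -- `X` gap
          exfalso
          have h1 := flat_fst_ge hρ (b := b) hx.1 hA
          have h2 := bend_fst_le hρ (b := b') h6 (by linarith)
          have hX : (flatPt ρ (flatU ρ x) b).1 = (bendPt ρ x' b').1 := by rw [heq]
          linarith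
      · -- both bend
        rw [pathShell_eq_bend hρ (q := (x, b)) (by simp only; linarith) (hle.trans hB')] at heq
        simp only at heq
        obtain ⟨hxx, hbb⟩ := bendPt_inj hρ (by linarith) (by linarith) (by linarith) (by linarith) hbρ hbρ' heq
        rw [hxx, hbb]
    · -- `x'` in the foot regime
      rw [pathShell_eq_foot hρ (q := (x', b')) (show π / 3 < x' by linarith)] at heq
      have hx'π : x' < π := by linarith [hx'.2]
      rcases le_or_gt x psiCut with hA | hB
      · -- `Y` gap: flat vs foot
        exfalso
        rw [pathShell_eq_flat hρ (q := (x, b)) (show x < π / 6 by linarith)] at heq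
        have h1 := flat_snd_abs_le hρ x b
        have h2 := foot_snd_ge hρ (b := b') hC'.le hx'π
        have hY : (flatPt ρ (flatU ρ x) b).2 = (footPt ρ (footY ρ x') b').2 := by rw [heq]
        have := le_abs_self ((flatPt ρ (flatU ρ x) b).2)
        linarith
      rcases lt_or_ge x (π / 3) with h3 | h3
      · -- `Y` gap: low bend vs foot
        exfalso
        rw [pathShell_eq_bend hρ (q := (x, b)) (by simp only; linarith) (by linarith)] at heq
        have h1 := bend_snd_le hρ (b := b) (by linarith) h3 hbρ
        have h2 := foot_snd_ge hρ (b := b') hC'.le hx'π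
        have hY : (bendPt ρ x b).2 = (footPt ρ (footY ρ x') b').2 := by rw [heq]
        linarith
      · -- both foot values
        have hxfoot : pathShell ρ (x, b) = footPt ρ (footY ρ x) b := by
          rcases le_or_gt x (π - Real.arctan 2) with hxl | hxg
          · rw [pathShell_eq_bend hρ (q := (x, b)) (by simp only; linarith) hxl]
            exact (footPt_eq_bendPt hρ h3 (by linarith) (footY_le hρ (by linarith) hxl) b).symm
          · exact pathShell_eq_foot hρ (q := (x, b)) (show π / 3 < x by linarith)
        rw [hxfoot] at heq
        have h := hI₂ (mk_mem_prod (footY_mem hρ h3 hx.2) hbJ) (mk_mem_prod (footY_mem hρ (by linarith) hx'.2) hbJ') heq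
        simp only [Prod.mk.injEq] at h
        have hxx := eq_of_footY_eq hρ.ne' ⟨by linarith, by linarith [hx.2]⟩ ⟨by linarith, hx'π⟩ h.1
        rw [hxx, h.2]
  rintro ⟨x, b⟩ ⟨hx, hb⟩ ⟨x', b'⟩ ⟨hx', hb'⟩ heq
  rcases le_total x x' with h | h
  · exact key x b x' b' hx hb hx' hb' heq h
  · exact (key x' b' x b hx' hb' hx hb heq.symm h).symm

end Shell

end Literature.Topology.FourManifolds
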